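import Literature.NumberTheory.EllipticCurves.ModularPolynomialHeight
import Literature.NumberTheory.Transcendental.MahlerManinFromModularPolynomial
import HarnessLib

/-!
# `𝓛_p(E) ≠ 0` and the Mahler–Manin theorem, unconditionally (discharge of the named facts)

Everything in this file is **proved**; there are no new definitions.  We close the two named facts

* `Literature.NumberTheory.Transcendental.MahlerManinPadic` (Barré-Sirieix–Diaz–Gramain–Philibert
  1996, Théorème 1, `p`-adic case: for `q ∈ ℚ_p` algebraic with `0 < ‖q‖_p < 1`, the value
  `J(q) = E₄(q)³/Δ(q)` is transcendental), by `MahlerManinPadic_holds`;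
* `WeierstrassCurve.LInvariant_ne_zero` (Mazur–Tate–Teitelbaum's
  `𝓛_p(E) = log_p q_E / ord_p q_E ≠ 0` for `E/ℚ` with a Tate parameter datum at `p`; BDGP 1996,
  corollary of Théorème 1), by `WeierstrassCurve.LInvariant_ne_zero_holds`,

by feeding the tree's height bound for the modular equations of prime level,
`Literature.NumberTheory.EllipticCurves.exists_norm_coeff_modularPolynomial_le`
(`ModularPolynomialHeight.lean`: `‖coeff Φ_ℓ‖ ≤ exp(c ℓ √ℓ)`, K. Mahler 1974), into
`mahlerManinPadic_of_modularPolynomial_height` and `lInvariant_ne_zero_of_modularPolynomial_height`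
(`MahlerManinFromModularPolynomial.lean`), which assemble the tree's formalisation of the
Barré-Sirieix–Diaz–Gramain–Philibert proof (`MahlerManinConclusion.lean` and its five steps, the
integer modular equations `intModularPolynomial`, the `q`-expansion bridge
`ModularRelationsPadic.lean`, and the reduction `PAdicHeightsLInvariantProofs.lean` through the
kernel `p^ℤ · μ` of the Iwasawa logarithm).

`WeierstrassCurve.LInvariant_ne_zero_holds` is a deliberate dot-notation extension of Mathlib's
`WeierstrassCurve` namespace (the fact lives there, `PAdicHeights.lean`), and
`MahlerManinPadic_holds` is declared by its absolute name in the namespace of its fact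
(`Transcendental/MahlerManin.lean`).

## References

* [BarreSirieixDiazGramainPhilibert1996Manin] K. Barré-Sirieix, G. Diaz, F. Gramain,
  G. Philibert, *Une preuve de la conjecture de Mahler–Manin*, Invent. Math. 124 (1996) 1–9,
  Théorème 1 and its corollary (`q_E` transcendental, hence `log_p q_E ≠ 0`).
* [MazurTateTeitelbaum1986Invent] B. Mazur, J. Tate, J. Teitelbaum, *On `p`-adic analogues of the
  conjectures of Birch and Swinnerton-Dyer*, Invent. Math. 84 (1986) 1–48, §II.1.
* [NesterenkoPhilippon2001] Yu. V. Nesterenko, P. Philippon (eds.), LNM 1752, Ch. 2 (G. Diaz),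
  Thm. 2.11.
-/

noncomputable section

namespace Literature.NumberTheory.Transcendental

/-- **The Mahler–Manin conjecture, `p`-adic case, is a theorem** (Barré-Sirieix–Diaz–Gramain–
Philibert 1996, Théorème 1): discharge of the named fact `MahlerManinPadic` — for every prime `p`
and every `q ∈ ℚ_p` with `0 < ‖q‖ < 1` algebraic over `ℚ`, `J(q) = tateJ q` is transcendental.
Assembled from `mahlerManinPadic_of_modularPolynomial_height` and Mahler's height bound
`exists_norm_coeff_modularPolynomial_le`. [cite: BarreSirieixDiazGramainPhilibert1996Manin, Théorème 1] -/
theorem MahlerManinPadic_holds : MahlerManinPadic :=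
  mahlerManinPadic_of_modularPolynomial_height
    Literature.NumberTheory.EllipticCurves.exists_norm_coeff_modularPolynomial_le

end Literature.NumberTheory.Transcendental

namespace WeierstrassCurve

variable {W : WeierstrassCurve ℚ} {p : ℕ} [Fact p.Prime]

/-- **Non-vanishing of the `𝓛`-invariant** (discharge of `WeierstrassCurve.LInvariant_ne_zero`):
for every elliptic curve `E/ℚ`, prime `p` and Tate parameter datum `D` at `p`,
`𝓛_p(E) = log_p q_E / ord_p q_E ≠ 0` — by the Mahler–Manin theorem (`MahlerManinPadic_holds`)
`q_E` is transcendental (`J(q_E) = j(E) ∈ ℚ`), so `q_E ∉ p^ℤ · μ(ℚ_p) = ker log_p`, while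
`ord_p q_E > 0` (Barré-Sirieix–Diaz–Gramain–Philibert 1996, corollary of Théorème 1; conjectured
by Mazur–Tate–Teitelbaum 1986, §II.1). [cite: BarreSirieixDiazGramainPhilibert1996Manin, Théorème 1, Cor.] -/
theorem LInvariant_ne_zero_holds : LInvariant_ne_zero (W := W) (p := p) :=
  LInvariant_ne_zero_of_mahlerManin Literature.NumberTheory.Transcendental.MahlerManinPadic_holds

end WeierstrassCurve

end
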